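import Literature.Probability.Percolation.TriClaim10Cycle
import Literature.Probability.Percolation.TriApproxDomainProofs
import HarnessLib

/-!
# Claim 10 of Bollobás–Riordan: `tri_sepEvent_diff_subset_disjointArms` (and its weak form) hold

Topic `Literature/Probability/Percolation`; family `crit-perc`. Discharge of the named facts
`tri_sepEvent_diff_subset_disjointArms` — **Claim 10** as printed (Bollobás–Riordan,
*Percolation* (2006), Ch. 7, pp. 177–179: on `Eⁱ(z) ∖ Eⁱ(w)` there are pairwise disjoint paths,
open from `x₁, x₂` to `A_{i+1}, A_{i+2}`, closed from `x₃` to `Aᵢ`) — and `tri_sepEvent_diff_subset_arms`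
(its weak form, `TriDiscreteDomain.lean`). In the frame of `A₀`
(`TriMarkedDomain.sepEvent_diff_subset_disjointArms_zero`): the separating path uses the bond
`x₁x₂`, its two parts split there are the open arms; `x₃` is off it and closed
(`TriClaim10Prep.lean`); following the interface from `w` (`closedArm_or_cycle₃`) gives the
closed arm — a closed path to `v₂` being excluded by the label of the faces at `v₂`
(`faceLabel_eq_leftLabel_add_one_of_mem_Ico`), the cycle by `cyc_false`
(`TriClaim10Cycle.lean`). The general arc by rotating the marks (`exists_rotate3`,
`sepEvent_eq_of_stretch_eq`). Theorems only; this removes Claim 10 from the named facts behind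
`hasCrossingLimit_triDomainCrossingProb_of_facts` and behind the reduction of Lemma 12
(`TriColourSwitching.lean`).

## References

* B. Bollobás, O. Riordan, *Percolation*, Cambridge University Press (2006), Ch. 7, Claim 10
  pp. 177–179.

## Mathlib / tree

Tree: `TriClaim10Prep.lean`, `TriClaim10Cycle.lean`, `TriIfaceOrbit3.lean`,
`TriApproxDomainProofs.lean` (`sepEvent_eq_of_stretch_eq`), `TriSepEscape.lean` (`remark`).
-/

noncomputable section

namespace Literature.Probability.Percolation

open LatticeModels Finset
open RemovableAt (hexFaceVertices_leftFaceDir)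

/-! ## Assembly: Claim 10 (weak form) in the frame of `A₀` -/

/-- A nonempty chain of adjacent sites carries a walk with that support. [folklore] -/
theorem exists_walk_of_isChain : ∀ (l : List (Site 2)) (hl : l ≠ []), List.IsChain triGraph.Adj l →
    ∃ p : triGraph.Walk (l.head hl) (l.getLast hl), p.support = l
  | [], hl, _ => absurd rfl hl
  | [a], _, _ => ⟨SimpleGraph.Walk.nil, rfl⟩
  | a :: b :: t, _, hc => by
    obtain ⟨hab, hc'⟩ := List.isChain_cons_cons.1 hc
    obtain ⟨q, hq⟩ := exists_walk_of_isChain (b :: t) (List.cons_ne_nil _ _) hc'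
    refine ⟨SimpleGraph.Walk.cons hab (q.copy rfl ?_), ?_⟩
    · rfl
    · rw [SimpleGraph.Walk.support_cons, SimpleGraph.Walk.support_copy, hq]; rfl

/-- Every site of a chain of sites of `A` is joined inside `A` to its first site. [folklore] -/
theorem pathIn_head_of_mem {A : Set (Site 2)} : ∀ (l : List (Site 2)) (hl : l ≠ []), List.IsChain triGraph.Adj l →
    (∀ s ∈ l, s ∈ A) → ∀ x ∈ l, PathIn triGraph A (l.head hl) x
  | [], hl, _, _, _, _ => absurd rfl hl
  | [a], _, _, hA, x, hx => by
    rw [List.mem_singleton] at hx; subst hx; exact PathIn.refl (hA _ (by simp))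
  | a :: b :: t, _, hc, hA, x, hx => by
    obtain ⟨hab, hc'⟩ := List.isChain_cons_cons.1 hc
    rcases List.mem_cons.1 hx with rfl | hx
    · exact PathIn.refl (hA _ (by simp))
    · have ih := pathIn_head_of_mem (b :: t) (List.cons_ne_nil _ _) hc' (fun s hs => hA s (List.mem_cons_of_mem _ hs)) x hx
      exact (PathIn.of_adj (hA _ (by simp)) (hA _ (by simp)) hab).trans ih

/-- **The bonds of a walk, as the bond set of its support.** [folklore] -/
theorem setOf_mem_edges_eq {u v : Site 2} (p : triGraph.Walk u v) :
    {e : Sym2 (Site 2) | e ∈ p.edges} = {e | ∃ d ∈ pathDarts p.support, e = s(d.1, d.2)} := by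
  ext e
  induction e using Sym2.ind with
  | _ x y =>
    simp only [Set.mem_setOf_eq]
    rw [sym2_mem_edges_iff_pathDarts]
    constructor
    · rintro (h | h)
      · exact ⟨_, h, rfl⟩
      · exact ⟨_, h, Sym2.eq_swap⟩
    · rintro ⟨d, hd, he⟩
      rcases Sym2.eq_iff.1 he with ⟨h1, h2⟩ | ⟨h1, h2⟩
      · left; rw [h1, h2]; exact hd
      · right; rw [h1, h2]; exact hd

/-- A list with a dart has at least two entries. [folklore] -/
theorem two_le_length_of_mem_pathDarts {l : List (Site 2)} {d : Site 2 × Site 2} (hd : d ∈ pathDarts l) : 2 ≤ l.length := by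
  match l, hd with
  | [], hd => simp at hd
  | [_], hd => simp at hd
  | _ :: _ :: _, _ => simp

namespace TriMarkedDomain

variable (D : TriMarkedDomain 3)

/-- **Claim 10 in the frame of `A₀`.** If `Sep⁰(z) ∖ Sep⁰(w)` holds, `z` the dual neighbour
of `w` across the side `x₁x₂` opposite `x₃ = x_r`, then there are pairwise disjoint simple
paths of `G`: open ones from `x₁` to `A₁` and from `x₂` to `A₂` (the two parts of the
separating path), and a closed one from `x₃` to `A₀`. Proof (Bollobás–Riordan pp. 177–179,
with the Jordan-curve steps replaced by winding labels): the separating path `P` uses the bond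
`x₁x₂` (`sym2_mem_bondSet_of_separates`) — whence the open arms along `P` — traversing it from
`x₁` to `x₂` with `w` on its left (`faceLabel_chordLoop_w`); `x₃` is off `P` and closed
(`faceVertex_not_mem_support`, `faceVertex_not_mem_of_not_mem`); following the interface from
`w` (`closedArm_or_cycle₃`) gives the closed arm (a closed path to `v₂` being excluded by the
label of the faces at `v₂`, `faceLabel_eq_leftLabel_add_one_of_mem_Ico`), the cycle being
impossible (`cyc_false`). [cite: BollobasRiordan2006, Ch. 7 Claim 10 pp. 177–179] -/
theorem sepEvent_diff_subset_disjointArms_zero (w : HexVertex) (r : Fin 3) (hw : hexFaceVertices w ⊆ D.verts) :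
    D.sepEvent 0 (oppFace w r) \ D.sepEvent 0 w ⊆
      {ω | ∃ (v₁ v₂ v₀ : Site 2) (P₁ : triGraph.Walk (faceVertex w (r + 1)) v₁)
          (P₂ : triGraph.Walk (faceVertex w (r + 2)) v₂) (P₀ : triGraph.Walk (faceVertex w r) v₀),
        P₁.IsPath ∧ P₂.IsPath ∧ P₀.IsPath ∧ v₁ ∈ D.arc 1 ∧ v₂ ∈ D.arc 2 ∧ v₀ ∈ D.arc 0 ∧
          (∀ x ∈ P₁.support, x ∈ D.verts ∧ x ∈ ω) ∧ (∀ x ∈ P₂.support, x ∈ D.verts ∧ x ∈ ω) ∧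
          (∀ x ∈ P₀.support, x ∈ D.verts ∧ x ∉ ω) ∧
          List.Disjoint P₁.support P₂.support ∧ List.Disjoint P₁.support P₀.support ∧
          List.Disjoint P₂.support P₀.support} := by
  classical
  intro ω hω
  obtain ⟨hz, hnw⟩ := hω
  set L := #(triBdryDarts D.verts) with hL
  set x := faceVertex w r with hx
  set a := faceVertex w (r + 1) with ha
  set b := faceVertex w (r + 2) with hb
  have h12 := D.pos_lt_pos₃ (show (1 : Fin 3) < 2 by decide)
  have h01 := D.pos_lt_pos₃ (show (0 : Fin 3) < 1 by decide)
  have h2L := D.pos_lt 2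
  -- the separating path, as a list
  obtain ⟨u, v, P, hP, hu, hv, hPG, hsep⟩ := hz
  change u ∈ D.arc 1 at hu
  change v ∈ D.arc 2 at hv
  set Q := P.support with hQ
  have hQne : Q ≠ [] := P.support_ne_nil
  have hQnd : Q.Nodup := hP.support_nodup
  have hQch : List.IsChain triGraph.Adj Q := P.isChain_adj_support
  have hQG : ∀ s ∈ Q, s ∈ D.verts := fun s hs => (hPG s hs).1
  have hQω : ∀ s ∈ Q, s ∈ ω := fun s hs => (hPG s hs).2
  have hQhead0 : Q.head hQne = u := P.head_support
  have hQlast0 : Q.getLast hQne = v := P.getLast_support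
  rw [setOf_mem_edges_eq] at hsep
  -- no admissible path separates `w`
  have hnotw : ∀ Q' : List (Site 2), (hne : Q' ≠ []) → Q'.Nodup → List.IsChain triGraph.Adj Q' →
      (∀ s ∈ Q', s ∈ D.verts ∧ s ∈ ω) → Q'.head hne ∈ D.arc 1 → Q'.getLast hne ∈ D.arc 2 →
      ¬ Separates D.verts {e : Sym2 (Site 2) | ∃ d ∈ pathDarts Q', e = s(d.1, d.2)} w (D.stretch 0) := by
    intro Q' hne hnd hch hGω hh hl hS
    apply hnw
    obtain ⟨p, hp⟩ := exists_walk_of_isChain Q' hne hch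
    refine ⟨_, _, p, ?_, hh, hl, fun s hs => hGω s (hp ▸ hs), ?_⟩
    · exact SimpleGraph.Walk.IsPath.mk' (by rw [hp]; exact hnd)
    · rw [setOf_mem_edges_eq, hp]; exact hS
  -- positions of the ends
  obtain ⟨nu, hnu, hnu'⟩ : ∃ nu, (D.pos 1 ≤ nu ∧ nu < D.pos 2) ∧ (triBdryIter D.verts D.base nu).1 = u := by
    unfold arc stretch at hu
    rw [D.nextPos_of_lt₃ 1 (by decide)] at hu
    simp only [Finset.mem_image, Finset.mem_Ico] at hu
    obtain ⟨d, ⟨n, hn, rfl⟩, hd⟩ := hu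
    exact ⟨n, hn, hd⟩
  obtain ⟨nv, hnv, hnv'⟩ : ∃ nv, (D.pos 2 ≤ nv ∧ nv < L) ∧ (triBdryIter D.verts D.base nv).1 = v := by
    unfold arc stretch at hv
    rw [D.nextPos_two₃] at hv
    simp only [Finset.mem_image, Finset.mem_Ico] at hv
    obtain ⟨d, ⟨n, hn, rfl⟩, hd⟩ := hv
    exact ⟨n, hn, hd⟩
  have hQhead : Q.head hQne = (triBdryIter D.verts D.base nu).1 := hQhead0.trans hnu'.symm
  have hQlast : Q.getLast hQne = (triBdryIter D.verts D.base nv).1 := hQlast0.trans hnv'.symm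
  -- Step 1: the path uses the bond `ab`
  have hns := hnotw Q hQne hQnd hQch hPG (by rw [hQhead0]; exact hu) (by rw [hQlast0]; exact hv)
  have hab := D.sym2_mem_bondSet_of_separates hw hsep hns
  have hQ2 : 2 ≤ Q.length := by
    obtain ⟨d₀, hd₀, -⟩ := hab
    exact two_le_length_of_mem_pathDarts hd₀
  -- the chord loop, the side of `w`, the orientation
  have hC := D.isTriLoop_chordLoop_frame hQne hQnd hQch hQG hQ2 hnu.2 hnv.1 hnv.2 hQhead hQlast
  obtain ⟨hπw, hdart, -⟩ := D.faceLabel_chordLoop_w hQne hQG hnu.1 hnu.2 hnv.1 hnv.2 hC hab hns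
  -- Step 3: `x` is off the path and closed
  have hxQ := D.faceVertex_not_mem_support hQne hQnd hQch hQG hQω (by rw [hQhead0]; exact hu) (by rw [hQlast0]; exact hv)
    hnu.1 hnu.2 hnv.1 hnv.2 hC hπw hnotw hw hdart
  have hxω := D.faceVertex_not_mem_of_not_mem hQne hQnd hQch hQG hQω (by rw [hQhead0]; exact hu) (by rw [hQlast0]; exact hv)
    hnu.1 hnu.2 hnv.1 hnv.2 hC hπw hnotw hw hdart hxQ
  -- Step 2: the open arms along the path: its two parts, split at the bond `ab`
  obtain ⟨haQ, hbQ⟩ := mem_of_mem_pathDarts hdart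
  obtain ⟨L₁, L₂, hQeq⟩ := exists_append_of_mem_pathDarts hdart
  have hQeq' : Q = (L₁ ++ [a]) ++ (b :: L₂) := by rw [hQeq, ha, hb]; simp
  have hnd' := List.nodup_append.1 (hQeq' ▸ hQnd)
  -- `P₁`: from `a` back to `u` along the initial part
  set R₁ := (L₁ ++ [a]).reverse with hR₁
  have hR₁ne : R₁ ≠ [] := by simp [hR₁]
  have hR₁head : R₁.head hR₁ne = a := by simp [hR₁]
  have hR₁last : R₁.getLast hR₁ne = u := by
    rw [← hQhead0]
    simp only [hR₁, List.getLast_reverse]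
    have key : ∀ (l : List (Site 2)) (hl : l ≠ []), l = (L₁ ++ [a]) ++ (b :: L₂) → (L₁ ++ [a]).head (by simp) = l.head hl := by
      intro l hl h; subst h; exact (List.head_append_of_ne_nil (by simp)).symm
    exact key Q hQne hQeq'
  have hR₁ch : List.IsChain triGraph.Adj R₁ := by
    rw [hR₁, List.isChain_reverse]
    exact ((hQeq' ▸ hQch).left_of_append).imp fun x y (h : triGraph.Adj x y) => h.symm
  obtain ⟨W₁, hW₁⟩ := exists_walk_of_isChain R₁ hR₁ne hR₁ch
  set P₁ : triGraph.Walk a u := W₁.copy hR₁head hR₁last with hP₁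
  have hP₁supp : P₁.support = R₁ := by rw [hP₁, SimpleGraph.Walk.support_copy, hW₁]
  have hP₁mem : ∀ x ∈ P₁.support, x ∈ L₁ ++ [a] := fun x hx => by
    rw [hP₁supp, hR₁, List.mem_reverse] at hx; exact hx
  -- `P₂`: from `b` on to `v` along the final part
  have hR₂ne : b :: L₂ ≠ [] := List.cons_ne_nil _ _
  have hR₂last : (b :: L₂).getLast hR₂ne = v := by
    rw [← hQlast0]
    have key : ∀ (l : List (Site 2)) (hl : l ≠ []), l = (L₁ ++ [a]) ++ (b :: L₂) → (b :: L₂).getLast hR₂ne = l.getLast hl := by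
      intro l hl h; subst h; exact (List.getLast_append_of_right_ne_nil _ _ hR₂ne).symm
    exact key Q hQne hQeq'
  have hR₂ch : List.IsChain triGraph.Adj (b :: L₂) := (hQeq' ▸ hQch).right_of_append
  obtain ⟨W₂, hW₂⟩ := exists_walk_of_isChain (b :: L₂) hR₂ne hR₂ch
  set P₂ : triGraph.Walk b v := W₂.copy rfl hR₂last with hP₂
  have hP₂supp : P₂.support = b :: L₂ := by rw [hP₂, SimpleGraph.Walk.support_copy, hW₂]
  -- Step 4: follow the interface from `w`
  have hxG : x ∈ D.verts := hw (faceVertex_mem _ _)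
  have haG : a ∈ D.verts := hw (faceVertex_mem _ _)
  have hbG : b ∈ D.verts := hw (faceVertex_mem _ _)
  have haω : a ∈ ω := hQω a haQ
  have hbω : b ∈ ω := hQω b hbQ
  have e1 : r + 1 + 1 = r + 2 := by rw [add_assoc]; rfl
  have e2 : r + 1 + 2 = r := by rw [add_assoc]; exact add_eq_left.2 (by decide)
  have e3 : r + 2 + 1 = r := by rw [add_assoc]; exact add_eq_left.2 (by decide)
  have e4 : r + 2 + 2 = r + 1 := by rw [add_assoc]; congr 1
  have hwab : leftFace a b = w := by rw [hb, ← e1, ha]; exact leftFace_faceVertex w (r + 1)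
  have hexit : D.IsExit₃ ω w (r + 1) := (D.isExit_iff₃).2 ⟨Or.inl (by rw [e1]; exact hbG),
    by rw [e1, D.vcol_eq_true_iff_of_mem₃ hbG]; exact hbω, by rw [e2, D.vcol_eq_false_iff_of_mem₃ hxG]; exact hxω⟩
  have hes : D.exitSide₃ ω w = r + 1 := D.exitSide_eq₃ hexit
  have hleftw : D.leftCell₃ ω w = x := by unfold leftCell₃; rw [hes, e2]
  have hrightw : D.rightCell₃ ω w = b := by unfold rightCell₃; rw [hes, e1]
  rcases D.closedArm_or_cycle₃ ω hexit (by rw [hleftw]; exact hxG) with ⟨p, hp, hpath⟩ | ⟨N, hN, hret, hcyc⟩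
  · rw [hleftw] at hpath
    rcases hp with hp | hp
    · -- the closed arm, made simple; the three arms
      obtain ⟨W₀, hW₀⟩ := hpath.exists_walk
      refine ⟨u, v, p, P₁, P₂, W₀.bypass, ?_, ?_, W₀.bypass_isPath, hu, hv, hp, ?_, ?_, ?_, ?_, ?_, ?_⟩
      · exact SimpleGraph.Walk.IsPath.mk' (by rw [hP₁supp, hR₁]; exact List.nodup_reverse.2 hnd'.1)
      · exact SimpleGraph.Walk.IsPath.mk' (by rw [hP₂supp]; exact hnd'.2.1)
      · intro y hy
        have hyQ : y ∈ Q := by rw [hQeq']; exact List.mem_append_left _ (hP₁mem y hy)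
        exact ⟨hQG y hyQ, hQω y hyQ⟩
      · intro y hy
        have hyQ : y ∈ Q := by rw [hQeq', ← hP₂supp]; exact List.mem_append_right _ hy
        exact ⟨hQG y hyQ, hQω y hyQ⟩
      · intro y hy
        obtain ⟨h1, h2⟩ := hW₀ y (W₀.support_bypass_subset_support hy)
        exact ⟨mem_coe.1 h1, h2⟩
      · intro y hy1 hy2
        rw [hP₂supp] at hy2
        exact hnd'.2.2 y (hP₁mem y hy1) y hy2 rfl
      · intro y hy1 hy2
        have hyQ : y ∈ Q := by rw [hQeq']; exact List.mem_append_left _ (hP₁mem y hy1)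
        exact (hW₀ y (W₀.support_bypass_subset_support hy2)).2 (hQω y hyQ)
      · intro y hy1 hy2
        have hyQ : y ∈ Q := by rw [hQeq', ← hP₂supp]; exact List.mem_append_right _ hy1
        exact (hW₀ y (W₀.support_bypass_subset_support hy2)).2 (hQω y hyQ)
    · -- a closed path from `x` to `v₂`: excluded by the label of the faces at `v₂`
      exfalso
      have hlen : nv + (nu + L - nv) = nu + L := by omega
      -- the sites of a closed path are not vertices of the chord loop (open sites and outer heads)
      have hA : ∀ z ∈ ((D.verts : Set (Site 2)) ∩ ωᶜ), ∀ d ∈ cycDarts (D.chordLoop Q nv (nu + L - nv)), d.1 ≠ z ∧ d.2 ≠ z := by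
        rintro z ⟨hzG, hzω⟩ d hd
        have hzG' : z ∈ D.verts := mem_coe.1 hzG
        rw [D.cycDarts_chordLoop hQne, List.mem_append, List.mem_cons, List.mem_append, List.mem_singleton] at hd
        rcases hd with hd | rfl | hd | rfl
        · obtain ⟨h1, h2⟩ := mem_of_mem_pathDarts hd
          exact ⟨fun e => hzω (e ▸ hQω _ h1), fun e => hzω (e ▸ hQω _ h2)⟩
        · exact ⟨fun e => hzω (e ▸ hQω _ (List.getLast_mem hQne)), fun e => D.bdryHead_not_mem nv (by simp only at e; rw [e]; exact hzG')⟩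
        · obtain ⟨r', -, -, -, rfl⟩ := D.mem_pathDarts_headsList hd
          exact ⟨fun e => D.bdryHead_not_mem r' (by simp only at e; rw [e]; exact hzG'),
            fun e => D.bdryHead_not_mem (r' + 1) (by simp only at e; rw [e]; exact hzG')⟩
        · exact ⟨fun e => D.bdryHead_not_mem _ (by simp only at e; rw [e]; exact hzG'), fun e => hzω (e ▸ hQω _ (List.head_mem hQne))⟩
      have hcell := cellLabel_eq_of_pathIn hC.adj hA hpath
      have hxcell : faceLabel (cycDarts (D.chordLoop Q nv (nu + L - nv))) w = cellLabel (cycDarts (D.chordLoop Q nv (nu + L - nv))) x :=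
        faceLabel_eq_cellLabel_of_mem hC.adj (hA x ⟨mem_coe.2 hxG, hxω⟩) (faceVertex_mem w r)
      have hv2mem : D.markSite 2 ∈ (D.verts : Set (Site 2)) ∩ ωᶜ := hp ▸ hpath.right_mem
      have hv2 : (triBdryIter D.verts D.base (D.pos 2 - 1)).1 = D.markSite 2 := by
        have := D.mark_pred 2
        rw [show D.pos 2 + (L - 1) = (D.pos 2 - 1) + L by omega, D.iter_add_card] at this
        exact this
      have hadj := D.adj_fst_bdryHead (D.pos 2 - 1)
      have hv2cell : faceLabel (cycDarts (D.chordLoop Q nv (nu + L - nv)))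
          (leftFace (triBdryIter D.verts D.base (D.pos 2 - 1)).1 (D.bdryHead (D.pos 2 - 1))) =
          cellLabel (cycDarts (D.chordLoop Q nv (nu + L - nv))) (D.markSite 2) := by
        rw [← hv2]
        exact faceLabel_eq_cellLabel_of_mem hC.adj (hA _ (hv2 ▸ hv2mem)) (by rw [hexFaceVertices_leftFace hadj]; simp)
      have hγ := D.faceLabel_eq_leftLabel_add_one_of_mem_Ico hQne hQG (nu := nu) (nv := nv) (len := nu + L - nv)
        (by omega) (by omega) hlen hQlast (by rw [hlen, D.iter_add_card]; exact hQhead) hC (q := D.pos 2 - 1)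
        (by omega) (by omega)
      rw [hv2cell, ← hp, ← hcell, ← hxcell, hπw] at hγ
      have key : ∀ a : ZMod 2, a ≠ a + 1 := by decide
      exact key _ hγ
  · -- the interface closes up: impossible
    exfalso
    set orb := partialOrbit (D.ifaceNext₃ ω) w with horbdef
    have horb : ∀ k < N, D.ifaceNext₃ ω (orb k) = some (orb (k + 1)) := fun k hk => (hcyc k hk).2.1
    have hleft : ∀ k < N, D.leftCell₃ ω (orb k) ∈ D.verts := fun k hk => (hcyc k hk).2.2.1
    have hw0 : orb 0 = w := rfl
    have hρ0 : D.rightCell₃ ω (orb 0) = b := hrightw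
    -- the walk re-enters `w` through the side `x₃x₁`, with `x₁` on its right
    have hentry : D.IsEntry₃ ω w (r + 2) := (D.isEntry_iff₃).2 ⟨Or.inr (by rw [e4]; exact haG),
      by rw [e3, D.vcol_eq_false_iff_of_mem₃ hxG]; exact hxω, by rw [e4, D.vcol_eq_true_iff_of_mem₃ haG]; exact haω⟩
    have hN1 : N - 1 < N := by omega
    have hsucc := D.cyc_succ_eq horb hN1
    rw [Nat.sub_add_cancel hN] at hsucc
    have hret' : orb N = w := hret
    rw [hret'] at hsucc
    obtain ⟨j, hj⟩ := D.cyc_exists_isExit horb hN1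
    have hE := D.isEntry_next₃ hj
    rw [← hsucc] at hE
    have hidx := D.isEntry_unique₃ hE hentry
    have hρN : D.rightCell₃ ω (orb (N - 1)) = a := by
      have := D.faceVertex_next_succ_succ₃ (B := ω) (orb (N - 1))
      rw [← hsucc, hidx, e4] at this
      exact this.symm
    exact D.cyc_false horb hleft hw0 hQeq hQnd hQch hQG hQω hnu.1 hnu.2 hnv.1 hnv.2 hQhead hQlast hC hπw hnotw hwab
      hN hρ0 hρN

end TriMarkedDomain

/-! ## Rotating the marks: Claim 10 (weak form) for every arc -/

/-- Injectivity on `Fin 3` from the three inequalities. [folklore] -/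
theorem injective_fin_three {α : Type*} {f : Fin 3 → α} (h01 : f 0 ≠ f 1) (h02 : f 0 ≠ f 2) (h12 : f 1 ≠ f 2) :
    Function.Injective f := by
  intro i j h
  fin_cases i <;> fin_cases j
  all_goals first
    | rfl
    | exact absurd h h01 | exact absurd h.symm h01 | exact absurd h h02 | exact absurd h.symm h02
    | exact absurd h h12 | exact absurd h.symm h12

namespace TriMarkedDomain

variable (D : TriMarkedDomain 3)

/-- The stretches of a 3-marked domain as images of position intervals. [folklore] -/
theorem stretch_eq_image3 (j : Fin 3) :
    D.stretch j = (Finset.Ico (D.pos j) (D.nextPos j)).image (triBdryIter D.verts D.base) := rfl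

/-- **Rotating the marks of a 3-marked domain**: for each `i` there is a 3-marked domain on the
same sites whose `j`-th stretch is the `(j + i)`-th stretch of `D` (re-mark at `vᵢ, vᵢ₊₁, vᵢ₊₂`,
positions read one period later where needed). [folklore] -/
theorem exists_rotate3 (i : Fin 3) : ∃ T : TriMarkedDomain 3, T.verts = D.verts ∧ ∀ j, T.stretch j = D.stretch (j + i) := by
  set L := #(triBdryDarts D.verts) with hLdef
  have h01 : D.pos 0 < D.pos 1 := D.pos_lt_pos₃ (by decide)
  have h12 : D.pos 1 < D.pos 2 := D.pos_lt_pos₃ (by decide)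
  have h2L : D.pos 2 < L := D.pos_lt 2
  have hp0 : D.pos 0 = 0 := D.pos_zero (by decide)
  have htail : ∀ n, (triBdryIter D.verts D.base (L + n)).1 = (triBdryIter D.verts D.base n).1 :=
    fun n => by rw [D.iter_card_add]
  have hmkL : ∀ n, D.Markable n → D.Markable (L + n) := fun n h => (D.markable_card_add).2 h
  have hmkL0 : D.Markable L := by
    have := hmkL _ (D.markable_pos 0)
    rwa [hp0, add_zero] at this
  have hmarkL : (triBdryIter D.verts D.base L).1 = D.markSite 0 := by
    rw [show L = L + 0 from rfl, htail, ← hp0]; rfl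
  have hvne : ∀ a b : Fin 3, a ≠ b → D.markSite a ≠ D.markSite b := fun a b hab h => hab (D.mark_injective h)
  have hs0 : D.stretch 0 = (Finset.Ico 0 (D.pos 1)).image (triBdryIter D.verts D.base) := by
    rw [stretch_eq_image3, D.nextPos_of_lt₃ 0 (by decide), hp0]; rfl
  have hs1 : D.stretch 1 = (Finset.Ico (D.pos 1) (D.pos 2)).image (triBdryIter D.verts D.base) := by
    rw [stretch_eq_image3, D.nextPos_of_lt₃ 1 (by decide)]; rfl
  have hs2 : D.stretch 2 = (Finset.Ico (D.pos 2) L).image (triBdryIter D.verts D.base) := by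
    rw [stretch_eq_image3, D.nextPos_two₃]
  fin_cases i
  · exact ⟨D, rfl, fun j => by simp⟩
  · -- marks `v₁, v₂, v₀ (+L)`
    obtain ⟨m, hm0, hm1, hm2⟩ : ∃ m : Fin 3 → ℕ, m 0 = D.pos 1 ∧ m 1 = D.pos 2 ∧ m 2 = L :=
      ⟨![D.pos 1, D.pos 2, L], rfl, rfl, rfl⟩
    have hm : StrictMono m := by
      refine Fin.strictMono_iff_lt_succ.2 fun j => ?_
      fin_cases j
      · show m 0 < m 1; omega
      · show m 1 < m 2; omega
    have hL' : ∀ j, m j < m 0 + L := by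
      intro j; fin_cases j
      · show m 0 < m 0 + L; omega
      · show m 1 < m 0 + L; omega
      · show m 2 < m 0 + L; omega
    have hmk' : ∀ j, D.Markable (m j) := by
      intro j; fin_cases j
      · show D.Markable (m 0); rw [hm0]; exact D.markable_pos 1
      · show D.Markable (m 1); rw [hm1]; exact D.markable_pos 2
      · show D.Markable (m 2); rw [hm2]; exact hmkL0
    have t0 : (triBdryIter D.verts D.base (m 0)).1 = D.markSite 1 := by rw [hm0]; rfl
    have t1 : (triBdryIter D.verts D.base (m 1)).1 = D.markSite 2 := by rw [hm1]; rfl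
    have t2 : (triBdryIter D.verts D.base (m 2)).1 = D.markSite 0 := by rw [hm2]; exact hmarkL
    have hinj : Function.Injective fun j => (triBdryIter D.verts D.base (m j)).1 := by
      refine injective_fin_three ?_ ?_ ?_
      · show (triBdryIter D.verts D.base (m 0)).1 ≠ (triBdryIter D.verts D.base (m 1)).1
        rw [t0, t1]; exact hvne 1 2 (by decide)
      · show (triBdryIter D.verts D.base (m 0)).1 ≠ (triBdryIter D.verts D.base (m 2)).1
        rw [t0, t2]; exact hvne 1 0 (by decide)
      · show (triBdryIter D.verts D.base (m 1)).1 ≠ (triBdryIter D.verts D.base (m 2)).1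
        rw [t1, t2]; exact hvne 2 0 (by decide)
    refine ⟨D.remark m hm hL' hmk' hinj, rfl, fun j => ?_⟩
    fin_cases j
    · show (D.remark m hm hL' hmk' hinj).stretch 0 = D.stretch (0 + 1)
      rw [remark_stretch, zero_add, hs1]
      unfold remarkNext; rw [dif_pos (by decide)]
      show Finset.image _ (Finset.Ico (m 0) (m 1)) = _
      rw [hm0, hm1]
    · show (D.remark m hm hL' hmk' hinj).stretch 1 = D.stretch (1 + 1)
      rw [remark_stretch, show (1 : Fin 3) + 1 = 2 from rfl, hs2]
      unfold remarkNext; rw [dif_pos (by decide)]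
      show Finset.image _ (Finset.Ico (m 1) (m 2)) = _
      rw [hm1, hm2]
    · show (D.remark m hm hL' hmk' hinj).stretch 2 = D.stretch (2 + 1)
      rw [remark_stretch, show (2 : Fin 3) + 1 = 0 from rfl, hs0]
      unfold remarkNext; rw [dif_neg (by decide)]
      show Finset.image _ (Finset.Ico (m 2) (m 0 + L)) = _
      rw [hm2, hm0, add_comm (D.pos 1) L, show Finset.Ico L (L + D.pos 1) = Finset.Ico (L + 0) (L + D.pos 1) by rw [add_zero],
        D.image_Ico_card_add]
  · -- marks `v₂, v₀ (+L), v₁ (+L)`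
    obtain ⟨m, hm0, hm1, hm2⟩ : ∃ m : Fin 3 → ℕ, m 0 = D.pos 2 ∧ m 1 = L ∧ m 2 = L + D.pos 1 :=
      ⟨![D.pos 2, L, L + D.pos 1], rfl, rfl, rfl⟩
    have hm : StrictMono m := by
      refine Fin.strictMono_iff_lt_succ.2 fun j => ?_
      fin_cases j
      · show m 0 < m 1; omega
      · show m 1 < m 2; omega
    have hL' : ∀ j, m j < m 0 + L := by
      intro j; fin_cases j
      · show m 0 < m 0 + L; omega
      · show m 1 < m 0 + L; omega
      · show m 2 < m 0 + L; omega
    have hmk' : ∀ j, D.Markable (m j) := by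
      intro j; fin_cases j
      · show D.Markable (m 0); rw [hm0]; exact D.markable_pos 2
      · show D.Markable (m 1); rw [hm1]; exact hmkL0
      · show D.Markable (m 2); rw [hm2]; exact hmkL _ (D.markable_pos 1)
    have t0 : (triBdryIter D.verts D.base (m 0)).1 = D.markSite 2 := by rw [hm0]; rfl
    have t1 : (triBdryIter D.verts D.base (m 1)).1 = D.markSite 0 := by rw [hm1]; exact hmarkL
    have t2 : (triBdryIter D.verts D.base (m 2)).1 = D.markSite 1 := by rw [hm2]; exact htail _
    have hinj : Function.Injective fun j => (triBdryIter D.verts D.base (m j)).1 := by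
      refine injective_fin_three ?_ ?_ ?_
      · show (triBdryIter D.verts D.base (m 0)).1 ≠ (triBdryIter D.verts D.base (m 1)).1
        rw [t0, t1]; exact hvne 2 0 (by decide)
      · show (triBdryIter D.verts D.base (m 0)).1 ≠ (triBdryIter D.verts D.base (m 2)).1
        rw [t0, t2]; exact hvne 2 1 (by decide)
      · show (triBdryIter D.verts D.base (m 1)).1 ≠ (triBdryIter D.verts D.base (m 2)).1
        rw [t1, t2]; exact hvne 0 1 (by decide)
    refine ⟨D.remark m hm hL' hmk' hinj, rfl, fun j => ?_⟩
    fin_cases j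
    · show (D.remark m hm hL' hmk' hinj).stretch 0 = D.stretch (0 + 2)
      rw [remark_stretch, zero_add, hs2]
      unfold remarkNext; rw [dif_pos (by decide)]
      show Finset.image _ (Finset.Ico (m 0) (m 1)) = _
      rw [hm0, hm1]
    · show (D.remark m hm hL' hmk' hinj).stretch 1 = D.stretch (1 + 2)
      rw [remark_stretch, show (1 : Fin 3) + 2 = 0 from rfl, hs0]
      unfold remarkNext; rw [dif_pos (by decide)]
      show Finset.image _ (Finset.Ico (m 1) (m 2)) = _
      rw [hm1, hm2, show Finset.Ico L (L + D.pos 1) = Finset.Ico (L + 0) (L + D.pos 1) by rw [add_zero],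
        D.image_Ico_card_add]
    · show (D.remark m hm hL' hmk' hinj).stretch 2 = D.stretch (2 + 2)
      rw [remark_stretch, show (2 : Fin 3) + 2 = 1 from rfl, hs1]
      unfold remarkNext; rw [dif_neg (by decide)]
      show Finset.image _ (Finset.Ico (m 2) (m 0 + L)) = _
      rw [hm2, hm0, add_comm (D.pos 2) L, D.image_Ico_card_add]

end TriMarkedDomain

/-- **Claim 10 of Bollobás–Riordan holds as printed**: `tri_sepEvent_diff_subset_disjointArms`
(`TriDiscreteDomain.lean`), by rotating the marks so that the arc in question is `A₀`
(`exists_rotate3`, `sepEvent_eq_of_stretch_eq`) and applying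
`sepEvent_diff_subset_disjointArms_zero`. [cite: BollobasRiordan2006, Ch. 7 Claim 10 pp. 177–179] -/
theorem tri_sepEvent_diff_subset_disjointArms_holds : tri_sepEvent_diff_subset_disjointArms := by
  intro D w r i hw
  obtain ⟨T, hTv, hTs⟩ := D.exists_rotate3 i
  have hsep : ∀ j z, T.sepEvent j z = D.sepEvent (j + i) z := TriMarkedDomain.sepEvent_eq_of_stretch_eq T D hTv i hTs
  have harc : ∀ j, T.arc j = D.arc (j + i) := fun j => by unfold TriMarkedDomain.arc; rw [hTs]
  have key := T.sepEvent_diff_subset_disjointArms_zero w (i + r) (by rw [hTv]; exact hw)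
  rw [hsep, hsep, zero_add, harc, harc, harc, hTv, zero_add, add_comm (1 : Fin 3) i, add_comm (2 : Fin 3) i,
    add_right_comm i r 1, add_right_comm i r 2] at key
  exact key

/-- **Claim 10, weak form, holds**: `tri_sepEvent_diff_subset_arms` (`TriDiscreteDomain.lean`),
the consequence used downstream, from the printed form. [cite: BollobasRiordan2006, Ch. 7 Claim 10 pp. 177–179] -/
theorem tri_sepEvent_diff_subset_arms_holds : tri_sepEvent_diff_subset_arms :=
  tri_sepEvent_diff_subset_arms_of_disjointArms tri_sepEvent_diff_subset_disjointArms_holds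

end Literature.Probability.Percolation
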